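import Mathlib
import HarnessLib.Audit
import Summits.PneNP.PneNP.Theorems.PstarCrossCaseTEqUnique
import Summits.PneNP.PneNP.Theorems.PstarCrossNoCompanion

/-!
# The blind free CROSS gate, regime T (node N3), the PRODUCT row: every real chord is (NOR) with respect to the flat `{μ₁ = μ₂ = 1}` (O2 / E1; prover-1 g23)

FRONTIER range-avoidance ladder, rung F-N3 (`stmt-PneNP-19007`), cell `pnp-ideate`; restricted-model proof complexity — nothing here bears on `P` versus `NP`.

Node N3 (`PstarCrossNodes.CrossCaseT`), the row `q_m = μ₁μ₂` (a non-degenerate product, `PstarCrossCaseTRows.caseT_row`).  For every real chord `e'`,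
`Z(u_{e'}) ⊆ Z(q_m)` (`forcing_of_real`), i.e. `u_{e'} ≡ 1` on `Z(q)` for `q := q_m + 1` — a quadratic whose polar form is `polarDir m`.  So
`PstarForcing.forcing_cases` applies: `q ≡ 1` (no: the product is non-degenerate), (EQ) `u_{e'} = μ₁μ₂ + κ` (no: rank), (EXC) — then by
`PstarNorUnitExcCore.exc_unit_core` a UNIT, whose polar formula would make the path `σ' — σ — τ — τ'` the Gram graph of the rank-two form `ℓ₁ ∧ ℓ₂` of the
product (eight booleans, `decide`: impossible) — or (NOR).

* **`caseT_product_nor`** — in the product row every real chord `e'` is (NOR) w.r.t. `q_m + 1`: `q_m + 1` is the NOR indicator of a codimension-two flat and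
  `Q_{D e'} + (γ_{e'} + 1)` lies in its ideal in the explicit form `(λ_b + 1)m₁ + (λ_a + 1)m₂` (the shape of `PstarNorUnitFinal.card_le_five_of_all_nor`'s
  hypothesis, for the successor's gluing argument).
With `PstarCrossCaseTEqUnique.crossCaseT_eq` this leaves of N3: the row `q_m ≡ 0`, and the all-(NOR) product row.
-/

set_option linter.dupNamespace false -- `Summit.PneNP.PneNP.…`: summit = sub-problem name (D-0017 single-conjunct layout)

open Finset Module Literature.Computability.Complexity
open Summit.PneNP.PneNP.Theorems.PstarTyped (Typed)
open Summit.PneNP.PneNP.Theorems.PstarSALevel (BoundaryExpanding SimpleOverlap)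
open Summit.PneNP.PneNP.Theorems.PstarGapLinearised (andPair)
open Summit.PneNP.PneNP.Theorems.PstarChordEndgameTools (mem_andPair_iff)
open Summit.PneNP.PneNP.Theorems.PstarCubeIdeals (IsAffineFn IsQuadFn)
open Summit.PneNP.PneNP.Theorems.PstarProductRank (qform polar)
open Summit.PneNP.PneNP.Theorems.PstarPathRank (AndAdj polar_basis and_ne)
open Summit.PneNP.PneNP.Theorems.PstarReadSumset (V2)
open Summit.PneNP.PneNP.Theorems.PstarRankRigidityTwo (affine_mul_polar symForm symForm_apply linPart linPart_apply)
open Summit.PneNP.PneNP.Theorems.PstarForcing (polar_unique not_rank_four_of_mul forcing_cases)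
open Summit.PneNP.PneNP.Theorems.PstarChordSystem (ChordSystem)
open Summit.PneNP.PneNP.Theorems.PstarChordBridgeTools
open Summit.PneNP.PneNP.Theorems.PstarChordBridge
open Summit.PneNP.PneNP.Theorems.PstarChordBridgeForcing (freeMon gam sys_u_eq qform_add' rank_four_of_wf)
open Summit.PneNP.PneNP.Theorems.PstarChordBridgeBasis (qDir polarDir)
open Summit.PneNP.PneNP.Theorems.PstarChordBridgeCorner (qDir_add)
open Summit.PneNP.PneNP.Theorems.PstarCrossData (CrossData)
open Summit.PneNP.PneNP.Theorems.PstarCrossSystem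
open Summit.PneNP.PneNP.Theorems.PstarCrossCaseT (forcing_of_real)
open Summit.PneNP.PneNP.Theorems.PstarCrossCaseU2 (u_add)
open Summit.PneNP.PneNP.Theorems.PstarCrossProductAlgebra (exists_eq_one_one)
open Summit.PneNP.PneNP.Theorems.PstarCrossCaseU2Touch (card_J₀_le)
open Summit.PneNP.PneNP.Theorems.PstarCrossNoCompanion (isQuadFn_shift)
open Summit.PneNP.PneNP.Theorems.PstarNorUnitExcCore (exc_unit_core)

namespace Summit.PneNP.PneNP.Theorems.PstarCrossCaseTProduct

variable {n m : ℕ}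

/-- The path `σ' — σ — τ — τ'` is not the Gram graph of a form `ℓ₁ ∧ ℓ₂`: eight booleans. -/
theorem path_ne_symForm : ∀ a₁ b₁ a₂ b₂ a₃ b₃ a₄ b₄ : ZMod 2,
    ¬ (a₁ * b₂ + a₂ * b₁ = 1 ∧ a₁ * b₃ + a₃ * b₁ = 0 ∧ a₁ * b₄ + a₄ * b₁ = 0 ∧ a₃ * b₄ + a₄ * b₃ = 1) := by
  decide

section

variable (I : LocalMap 4 n m) {r : ℕ} {B : BridgeData n m} {e_p e_q g₀ : Fin m}

/-- **In the product row of regime T every real chord is (NOR) w.r.t. `q_m + 1`.**  See the module docstring. -/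
theorem caseT_product_nor (hI : I.IsPure xorAndPred) (hT : Typed I) (hS : SimpleOverlap I) (hB : BoundaryExpanding r I)
    (hD : CrossData I r B e_p e_q g₀) {mv : V2} (hmvT : mv = (0, 1) ∨ mv = (1, 1))
    (hline : ∀ e ∈ (B.N.erase e_q).erase e_p,
      (((sys I B).vsys e_p e_q).ρ e 0 = 0 ∨ ((sys I B).vsys e_p e_q).ρ e 0 = mv) ∧
      (((sys I B).vsys e_p e_q).ρ' e 0 = 0 ∨ ((sys I B).vsys e_p e_q).ρ' e 0 = mv))
    (hread : ∀ e ∈ (B.N.erase e_q).erase e_p, ((sys I B).vsys e_p e_q).ρ e 0 ≠ 0 ∨ ((sys I B).vsys e_p e_q).ρ' e 0 ≠ 0)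
    {μ₁ μ₂ : (Fin n → ZMod 2) → ZMod 2} (h₁ : IsAffineFn μ₁) (h₂ : IsAffineFn μ₂)
    (hn₁ : ∃ z, μ₁ z ≠ μ₁ 0) (hn₂ : ∃ z, μ₂ z ≠ μ₂ 0) (hn : ∃ z, μ₁ z + μ₁ 0 ≠ μ₂ z + μ₂ 0) (hq : ∀ x, qDir I B mv x = μ₁ x * μ₂ x)
    {e' : Fin m} (he' : e' ∈ (B.N.erase e_q).erase e_p) :
    ∃ a b : Fin n → ZMod 2, polarDir I B mv a b = 1 ∧
      (∀ x, qDir I B mv x + 1 =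
        (polarDir I B mv x b + ((qDir I B mv b + 1) + (qDir I B mv 0 + 1))) * (polarDir I B mv x a + ((qDir I B mv a + 1) + (qDir I B mv 0 + 1))) + 1) ∧
      ∃ m₁ m₂ : (Fin n → ZMod 2) → ZMod 2, IsAffineFn m₁ ∧ IsAffineFn m₂ ∧
        ∀ x, (sys I B).u e' x + 1 =
          (polarDir I B mv x b + ((qDir I B mv b + 1) + (qDir I B mv 0 + 1)) + 1) * m₁ x +
          (polarDir I B mv x a + ((qDir I B mv a + 1) + (qDir I B mv 0 + 1)) + 1) * m₂ x := by
  classical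
  have hW := hD.wf
  have he'N : e' ∈ B.N := mem_of_mem_erase (mem_of_mem_erase he')
  have he'J : e' ∈ B.J₀ := hW.hN he'N
  have hrank := rank_four_of_wf I hI hS hB hW (card_J₀_le I hD) he'N
  have hu := u_add I B e'
  have e01 : ∀ t : ZMod 2, t = 0 ∨ t = 1 := by decide
  -- `q := q_m + 1`, `u_{e'} ≡ 1` on `Z(q)`
  have hqB : ∀ x w, qDir I B mv (x + w) + 1 = qDir I B mv x + 1 + (qDir I B mv w + 1) + (qDir I B mv 0 + 1) + polarDir I B mv x w :=
    isQuadFn_shift I B mv 1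
  have hZ : ∀ x, qDir I B mv x + 1 = 0 → (sys I B).u e' x = 1 := fun x hx => by
    rcases e01 ((sys I B).u e' x) with h0 | h1
    · have h := (forcing_of_real I hI hT hD hmvT hline hread he' h0).2
      rw [h, zero_add] at hx
      exact absurd hx one_ne_zero
    · exact h1
  rcases forcing_cases (q := fun x => qDir I B mv x + 1) (Q := (sys I B).u e') hqB hu hrank hZ with
      hone | ⟨κ, hEQ⟩ | ⟨ν₁, ν₂, hν₁, hν₂, κ, hEXC⟩ | ⟨a, b, hab, hqf, m₁, m₂, hm₁, hm₂, hnor⟩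
  · -- `q ≡ 1`: the product vanishes identically
    exfalso
    obtain ⟨y, hy₁, hy₂⟩ := exists_eq_one_one h₁ h₂ hn₁ hn₂ hn 1 1
    have h := hone y
    rw [hq y, hy₁, hy₂] at h
    exact absurd h (by decide)
  · -- (EQ): `u_{e'} = μ₁μ₂ + (1 + κ)`, rank two
    exfalso
    exact not_rank_four_of_mul hu h₁ h₂ (κ := 1 + κ) (fun x => by rw [hEQ x, hq x, add_assoc]) hrank
  · -- (EXC): a unit, whose polar formula contradicts `polarDir = ℓ₁ ∧ ℓ₂`; or (EQ) again
    exfalso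
    have hr : (B.J₀ ∪ B.G₁ ∪ B.G₂).card ≤ r := by
      refine le_trans (card_le_card ?_) hD.rad
      exact union_subset_union (union_subset_union subset_rfl (subset_insert g₀ B.G₁)) subset_rfl
    have hd₁ : Disjoint B.G₁ B.J₀ := Finset.disjoint_of_subset_left (subset_insert g₀ B.G₁) hD.disj₁
    have heG : e' ∉ B.G₁ ∪ B.G₂ := by
      rw [mem_union, not_or]
      exact ⟨fun h => Finset.disjoint_left.1 hd₁ h he'J, fun h => Finset.disjoint_left.1 hD.disj₂ h he'J⟩
    have hZ' : ∀ x, qDir I B mv x + 1 = 0 → qform (B.D e') (fun j => I.vars j 2) (fun j => I.vars j 3) x = 1 + gam B e' := fun x hx => by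
      have h := hZ x hx
      rw [sys_u_eq] at h
      have e2 : ∀ g Q : ZMod 2, g + Q = 1 → Q = 1 + g := by decide
      exact e2 _ _ h
    have hEXC' : ∀ x, qform (B.D e') (fun j => I.vars j 2) (fun j => I.vars j 3) x = (qDir I B mv x + 1) + ν₁ x * ν₂ x + (κ + gam B e') := fun x => by
      have h := hEXC x
      rw [sys_u_eq] at h
      have e3 : ∀ g Q q N k : ZMod 2, g + Q = q + N + k → Q = q + N + (k + g) := by decide
      exact e3 _ _ _ _ _ h
    rcases exc_unit_core I hI hS hB hW hr he'N heG mv hqB hZ' hν₁ hν₂ hEXC' with ⟨κ', hEQ⟩ | ⟨j₁, j₂, σ, τ, -, hDe, hdisj, hσ, hτ, -, hpol, -⟩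
    · refine not_rank_four_of_mul hu h₁ h₂ (κ := 1 + κ' + gam B e') (fun x => ?_) hrank
      rw [sys_u_eq, hEQ x, hq x]
      have e4 : ∀ p g k : ZMod 2, g + (p + 1 + k) = p + (1 + k + g) := by decide
      exact e4 _ _ _
    · -- `polarDir mv = ℓ₁ ∧ ℓ₂` on basis vectors vs the unit formula on `σ', σ, τ, τ'`
      have hsym : ∀ v w : Fin n, polarDir I B mv (Pi.single v 1) (Pi.single w 1) =
          (μ₁ (Pi.single v 1) + μ₁ 0) * (μ₂ (Pi.single w 1) + μ₂ 0) + (μ₁ (Pi.single w 1) + μ₁ 0) * (μ₂ (Pi.single v 1) + μ₂ 0) := by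
        have hpe : polarDir I B mv = symForm (linPart h₁) (linPart h₂) :=
          polar_unique (Q := qDir I B mv) (qDir_add I B mv) fun x w => by rw [hq, hq, hq, hq]; exact affine_mul_polar h₁ h₂ x w
        intro v w
        rw [hpe, symForm_apply, linPart_apply, linPart_apply, linPart_apply, linPart_apply]
      obtain ⟨σ', hσ'j, hσσ'⟩ : ∃ σ' : Fin n, σ' ∈ andPair I j₁ ∧ σ' ≠ σ := by
        rcases (mem_andPair_iff I j₁ σ).1 hσ with h | h
        · exact ⟨I.vars j₁ 3, (mem_andPair_iff I j₁ _).2 (Or.inr rfl), fun e => and_ne I hI j₁ (h.symm.trans e.symm)⟩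
        · exact ⟨I.vars j₁ 2, (mem_andPair_iff I j₁ _).2 (Or.inl rfl), fun e => and_ne I hI j₁ (e.trans h)⟩
      obtain ⟨τ', hτ'j, hττ'⟩ : ∃ τ' : Fin n, τ' ∈ andPair I j₂ ∧ τ' ≠ τ := by
        rcases (mem_andPair_iff I j₂ τ).1 hτ with h | h
        · exact ⟨I.vars j₂ 3, (mem_andPair_iff I j₂ _).2 (Or.inr rfl), fun e => and_ne I hI j₂ (h.symm.trans e.symm)⟩
        · exact ⟨I.vars j₂ 2, (mem_andPair_iff I j₂ _).2 (Or.inl rfl), fun e => and_ne I hI j₂ (e.trans h)⟩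
      have dj : ∀ {c d : Fin n}, c ∈ andPair I j₁ → d ∈ andPair I j₂ → c ≠ d := fun hc hd e => Finset.disjoint_left.1 hdisj hc (e ▸ hd)
      have hσ'τ : σ' ≠ τ := dj hσ'j hτ
      have hσ'τ' : σ' ≠ τ' := dj hσ'j hτ'j
      have hστ : σ ≠ τ := dj hσ hτ
      have hστ' : σ ≠ τ' := dj hσ hτ'j
      have hAdj_of : ∀ {c d : Fin n}, AndAdj I (B.D e') c d → (c ∈ andPair I j₁ ∧ d ∈ andPair I j₁) ∨ (c ∈ andPair I j₂ ∧ d ∈ andPair I j₂) := by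
        rintro c d ⟨j, hj, hcd⟩
        rw [hDe, mem_insert, mem_singleton] at hj
        rcases hj with rfl | rfl
        · left
          rcases hcd with ⟨e1, e2⟩ | ⟨e1, e2⟩
          · exact ⟨(mem_andPair_iff I _ _).2 (Or.inl e1.symm), (mem_andPair_iff I _ _).2 (Or.inr e2.symm)⟩
          · exact ⟨(mem_andPair_iff I _ _).2 (Or.inr e2.symm), (mem_andPair_iff I _ _).2 (Or.inl e1.symm)⟩
        · right
          rcases hcd with ⟨e1, e2⟩ | ⟨e1, e2⟩
          · exact ⟨(mem_andPair_iff I _ _).2 (Or.inl e1.symm), (mem_andPair_iff I _ _).2 (Or.inr e2.symm)⟩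
          · exact ⟨(mem_andPair_iff I _ _).2 (Or.inr e2.symm), (mem_andPair_iff I _ _).2 (Or.inl e1.symm)⟩
      have hcross : ∀ {c d : Fin n}, c ∈ andPair I j₁ → d ∈ andPair I j₂ → ¬ AndAdj I (B.D e') c d := by
        intro c d hc hd hA
        rcases hAdj_of hA with ⟨-, hd'⟩ | ⟨hc', -⟩
        · exact Finset.disjoint_left.1 hdisj hd' hd
        · exact Finset.disjoint_left.1 hdisj hc hc'
      have hpair : ∀ j : Fin m, ∀ {c d : Fin n}, c ∈ andPair I j → d ∈ andPair I j → c ≠ d →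
          (I.vars j 2 = c ∧ I.vars j 3 = d) ∨ (I.vars j 2 = d ∧ I.vars j 3 = c) := by
        intro j c d hc hd hcd
        rcases (mem_andPair_iff I j c).1 hc with e1 | e1 <;> rcases (mem_andPair_iff I j d).1 hd with e2 | e2
        · exact absurd (e1.trans e2.symm) hcd
        · exact Or.inl ⟨e1.symm, e2.symm⟩
        · exact Or.inr ⟨e2.symm, e1.symm⟩
        · exact absurd (e1.trans e2.symm) hcd
      have hj₁D : j₁ ∈ B.D e' := by rw [hDe]; exact mem_insert_self _ _
      have hj₂D : j₂ ∈ B.D e' := by rw [hDe]; exact mem_insert_of_mem (mem_singleton_self _)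
      -- the four Gram values `σ'σ = 1`, `σ'τ = 0`, `σ'τ' = 0`, `ττ' = 1`
      have g1 : polarDir I B mv (Pi.single σ' 1) (Pi.single σ 1) = 1 := by
        rw [hpol, if_pos ⟨j₁, hj₁D, hpair j₁ hσ'j hσ hσσ'⟩, if_neg, add_zero]
        rintro (⟨h, -⟩ | ⟨h, -⟩); exacts [hσσ' h, hσ'τ h]
      have g2 : polarDir I B mv (Pi.single σ' 1) (Pi.single τ 1) = 0 := by
        rw [hpol, if_neg (hcross hσ'j hτ), if_neg, add_zero]
        rintro (⟨h, -⟩ | ⟨h, -⟩); exacts [hσσ' h, hσ'τ h]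
      have g3 : polarDir I B mv (Pi.single σ' 1) (Pi.single τ' 1) = 0 := by
        rw [hpol, if_neg (hcross hσ'j hτ'j), if_neg, add_zero]
        rintro (⟨h, -⟩ | ⟨h, -⟩); exacts [hσσ' h, hσ'τ h]
      have g4 : polarDir I B mv (Pi.single τ 1) (Pi.single τ' 1) = 1 := by
        rw [hpol, if_pos ⟨j₂, hj₂D, hpair j₂ hτ hτ'j hττ'.symm⟩, if_neg, add_zero]
        rintro (⟨h, -⟩ | ⟨-, h⟩); exacts [hστ.symm h, hστ' h.symm]
      rw [hsym] at g1 g2 g3 g4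
      exact path_ne_symForm _ _ _ _ _ _ _ _ ⟨g1, g2, g3, g4⟩
  · exact ⟨a, b, hab, hqf, m₁, m₂, hm₁, hm₂, hnor⟩

end

end Summit.PneNP.PneNP.Theorems.PstarCrossCaseTProduct
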